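import Summits.CriticalPhenomena.PercolationContinuityZ3.Theorems.NearLinearTwoClusterDecay.Negative.BoundedAspectGeometry
import Summits.CriticalPhenomena.PercolationContinuityZ3.Theorems.NearLinearTwoClusterDecay.Negative.Dichotomy
import Summits.CriticalPhenomena.PercolationContinuityZ3.Theorems.NearLinearTwoClusterDecay.Negative.AspectCrossingPos
import Summits.CriticalPhenomena.PercolationContinuityZ3.Theorems.NearLinearTwoClusterDecay.Negative.SlabTiling
import Summits.CriticalPhenomena.PercolationContinuityZ3.Theorems.NearLinearTwoClusterDecay.Negative.PlateCrossing
import Summits.CriticalPhenomena.PercolationContinuityZ3.Theorems.NearLinearTwoClusterDecay.Negative.Structure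
import HarnessLib

/-!
# The PRINT BOUNDARY of the crux: at every BOUNDED aspect the two-cluster event is not rare
# (van den Berg–van Engelenburg 2022, Prop. 2 — bond percolation on `ℤ³`; vdBvE programme, assembly II)

Negative-side structure for the crux `U(1/6)` = `NearLinearTwoClusterDecay` (stmt-CriticalPhenomena-5785;
at `p_c(ℤ³)`, `P(A₂(n, ⌈n^{7/6}⌉)) → 0`), line `critical-orange-peeling`, lead seat c2.  `A₂(k,m)` = two
sites of `Λ(k)` joined inside `Λ(m)` to `∂ⁱⁿΛ(m)` but not to each other (the crux event at general radii).

* `twoCluster_boundedAspect_pos` : `∀ M ≥ 2, ∃ δ > 0, ∀ n ≥ 1, δ ≤ P_{p_c}(A₂(4n, M·4n)) ∨ δ ≤ P_{p_c}(A₂(aₙ, M·aₙ))`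
  with `aₙ = 8Mn + 2` — so along a scale sequence with bounded gaps the aspect-`M` two-cluster event keeps
  probability `≥ δ(M)`;
* `twoCluster_boundedAspect_frequently` : `∀ M ≥ 2, ∃ δ > 0, ∃ᶠ k, δ ≤ P_{p_c}(A₂(k, Mk))`;
* `not_tendsto_twoCluster_boundedAspect` : **`∀ M ≥ 2, ¬ (P_{p_c}(A₂(n, Mn)) → 0)`** — the crux with its
  aspect `⌈n^{7/6}⌉ / n = n^{1/6} → ∞` replaced by ANY bounded multiplicative aspect is FALSE: `b > 0` in
  `U(b)` is essential.  This was the standing disprover's only `sorry`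
  (`Cruxes/NearLinearTwoClusterDecay/Disproof.lean` §(e) `not_tendsto_bounded_multiplicative_aspect`).

Proof (arXiv:2009.13337 §3, transcribed to bond percolation with the one-arm form of Lemma 6): fix `M ≥ 2`,
`n ≥ 1`; by the critical dichotomy (`critTwoCluster_dichotomy`, `ε₀(M)`), EITHER `P(A₂(4n,4Mn)) ≥ ε₀/2`, OR the
one-arm crossing `Λ(n) → ∂ⁱⁿΛ(16Mn)` fails with probability `≥ ε₀/2`.  In the second case put `h = 8Mn+1`,
`a = h+1`, `b = 4M·h`: by slab tiling + Harris (`slabCrossing_le_of_tiling`) the slab `Λ(b) ∩ {|v₂| ≤ h}` has NO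
open vertical crossing with probability `≥ (ε₀/2)^{K₀(M)}` (the closed barrier `E₁`); by critical aspect-`4M`
crossing positivity (`critAspectCrossing_pos`), the face decomposition (`crossing_le_sum_faces`), lattice
symmetry (`face_symmetry`) and plate tiling + Harris (`face_le_of_plates`), the plate arm `F⁺(a,b)` has
probability `≥ f₀(M) > 0`; and `(1 - P(V)) · P(F⁺)² ≤ P(A₂(a,b))` (`twoCluster_ge_barrier_mul_plate_sq`:
`E₁ ∩ F₂ ∩ F₃ ⊆ A₂`, independence, reflection).  Finally `P(A₂(a, Ma)) ≥ P(A₂(a,b))` because `Ma ≤ b`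
(antitone in the outer box, `real_twoClusterEvt_antitone`).
-/

noncomputable section

namespace Summit.CriticalPhenomena.PercolationContinuityZ3.Theorems.NearLinearTwoClusterDecay.Negative

open MeasureTheory Filter Topology
open Literature.Probability.LatticeModels Literature.Probability.Percolation
open Literature.Probability.Percolation.DCT16

namespace BoundedAspect

/-- The plate-arm floor `f₀ = 1 - (1 - c/6)^{1/J}` is positive for `0 < c ≤ 6`, `J ≠ 0`. -/
theorem floor_pos {c : ℝ} {J : ℕ} (hJ : J ≠ 0) (hc : 0 < c) (hc6 : c ≤ 6) :
    0 < 1 - (1 - c / 6) ^ ((J : ℝ)⁻¹) := by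
  have h1 : (1 - c / 6) ^ ((J : ℝ)⁻¹) < 1 :=
    Real.rpow_lt_one (by linarith) (by linarith) (by positivity)
  linarith

/-- The crux event is antitone in the outer radius (inline form of `real_twoClusterEvt_antitone`). -/
theorem real_twoCluster_antitone {k m m' : ℕ} (hkm : k ≤ m) (hmm' : m ≤ m') :
    (bondPercolation (zdGraph 3) (criticalProbI 3)).real
        {ω | ∃ x ∈ box 3 k, ∃ x' ∈ box 3 k, ∃ y ∈ innerBoundary (zdGraph 3) (box 3 m'),
          ∃ y' ∈ innerBoundary (zdGraph 3) (box 3 m'),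
            ω ∈ openConnIn (↑(box 3 m') : Set (Site 3)) x y ∧ ω ∈ openConnIn (↑(box 3 m') : Set (Site 3)) x' y' ∧
            ω ∉ openConnIn (↑(box 3 m') : Set (Site 3)) x x'} ≤
      (bondPercolation (zdGraph 3) (criticalProbI 3)).real
        {ω | ∃ x ∈ box 3 k, ∃ x' ∈ box 3 k, ∃ y ∈ innerBoundary (zdGraph 3) (box 3 m),
          ∃ y' ∈ innerBoundary (zdGraph 3) (box 3 m),
            ω ∈ openConnIn (↑(box 3 m) : Set (Site 3)) x y ∧ ω ∈ openConnIn (↑(box 3 m) : Set (Site 3)) x' y' ∧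
            ω ∉ openConnIn (↑(box 3 m) : Set (Site 3)) x x'} :=
  real_twoClusterEvt_antitone hkm hmm'

/-- `P(cross(n,m)ᶜ) = 1 - P(cross(n,m))` (the crossing event is a local, hence measurable, event). -/
theorem real_noCross_eq (p : unitInterval) (n m : ℕ) :
    (bondPercolation (zdGraph 3) p).real
        {ω : BondConfig (Site 3) | ¬ ∃ x ∈ box 3 n, ∃ y ∈ innerBoundary (zdGraph 3) (box 3 m),
          ω ∈ openConnIn (↑(box 3 m) : Set (Site 3)) x y} =
      1 - (bondPercolation (zdGraph 3) p).real
        {ω : BondConfig (Site 3) | ∃ x ∈ box 3 n, ∃ y ∈ innerBoundary (zdGraph 3) (box 3 m),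
          ω ∈ openConnIn (↑(box 3 m) : Set (Site 3)) x y} := by
  have hmeas : MeasurableSet {ω : BondConfig (Site 3) | ∃ x ∈ box 3 n, ∃ y ∈ innerBoundary (zdGraph 3) (box 3 m),
      ω ∈ openConnIn (↑(box 3 m) : Set (Site 3)) x y} :=
    (AspectCrossingPos.determinedBy_cross n m).measurableSet_of_finset
  rw [show {ω : BondConfig (Site 3) | ¬ ∃ x ∈ box 3 n, ∃ y ∈ innerBoundary (zdGraph 3) (box 3 m),
      ω ∈ openConnIn (↑(box 3 m) : Set (Site 3)) x y} =
      {ω : BondConfig (Site 3) | ∃ x ∈ box 3 n, ∃ y ∈ innerBoundary (zdGraph 3) (box 3 m),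
        ω ∈ openConnIn (↑(box 3 m) : Set (Site 3)) x y}ᶜ from rfl,
    measureReal_compl hmeas, probReal_univ]

/-- **The second mechanism (case B of the dichotomy), quantified.** For `M ≥ 2` there are `K₀`, `f₀ > 0`
such that for every `n ≥ 1` and `0 ≤ η ≤ 1` with `P_{p_c}(Λ(n) ↮ ∂ⁱⁿΛ(16Mn)) ≥ η`, putting `h = 8Mn+1`,
`a = h + 1`, `b = 4M·h`:  `η^{K₀} · f₀² ≤ P_{p_c}(A₂(a, b))`. -/
theorem caseB (M : ℕ) (hM : 2 ≤ M) :
    ∃ K₀ : ℕ, ∃ f₀ : ℝ, 0 < f₀ ∧ ∀ (n : ℕ), 1 ≤ n → ∀ η : ℝ, 0 ≤ η → η ≤ 1 →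
      η ≤ (bondPercolation (zdGraph 3) (criticalProbI 3)).real
          {ω : BondConfig (Site 3) | ¬ ∃ x ∈ box 3 n, ∃ y ∈ innerBoundary (zdGraph 3) (box 3 (16 * M * n)),
            ω ∈ openConnIn (↑(box 3 (16 * M * n)) : Set (Site 3)) x y} →
      η ^ K₀ * f₀ ^ 2 ≤ (bondPercolation (zdGraph 3) (criticalProbI 3)).real
          {ω | ∃ x ∈ box 3 (8 * M * n + 1 + 1), ∃ x' ∈ box 3 (8 * M * n + 1 + 1),
            ∃ y ∈ innerBoundary (zdGraph 3) (box 3 (4 * M * (8 * M * n + 1))),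
            ∃ y' ∈ innerBoundary (zdGraph 3) (box 3 (4 * M * (8 * M * n + 1))),
              ω ∈ openConnIn (↑(box 3 (4 * M * (8 * M * n + 1))) : Set (Site 3)) x y ∧
              ω ∈ openConnIn (↑(box 3 (4 * M * (8 * M * n + 1))) : Set (Site 3)) x' y' ∧
              ω ∉ openConnIn (↑(box 3 (4 * M * (8 * M * n + 1))) : Set (Site 3)) x x'} := by
  -- critical crossing positivity at aspect `4M`, and the two constants
  obtain ⟨c, hc, hcross⟩ := critAspectCrossing_pos (4 * M) (by omega)
  have hc1 : c ≤ 1 := (hcross 1 le_rfl).trans measureReal_le_one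
  have hJ₀0 : (2 * (4 * M) + 3) ^ 2 ≠ 0 := by positivity
  refine ⟨(2 * (4 * M * (8 * M + 1)) + 3) ^ 2, 1 - (1 - c / 6) ^ ((((2 * (4 * M) + 3) ^ 2 : ℕ) : ℝ)⁻¹),
    floor_pos hJ₀0 hc (by linarith), fun n hn η hη0 hη1 hηle => ?_⟩
  -- arithmetic of the radii `h = 8Mn+1`, `a = h+1`, `b = 4M·h`
  have hh1 : 1 ≤ 8 * M * n + 1 := by omega
  have h4M : 4 * 2 ≤ 4 * M := Nat.mul_le_mul_left 4 hM
  have hab : 8 * M * n + 1 + 1 ≤ 4 * M * (8 * M * n + 1) :=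
    calc 8 * M * n + 1 + 1 ≤ 4 * 2 * (8 * M * n + 1) := by omega
      _ ≤ 4 * M * (8 * M * n + 1) := Nat.mul_le_mul_right _ h4M
  have hlt : 8 * M * n + 1 + 1 < 4 * M * (8 * M * n + 1) :=
    calc 8 * M * n + 1 + 1 < 4 * 2 * (8 * M * n + 1) := by omega
      _ ≤ 4 * M * (8 * M * n + 1) := Nat.mul_le_mul_right _ h4M
  have hhb : 8 * M * n + 1 ≤ 4 * M * (8 * M * n + 1) := by omega
  have hbn : 4 * M * (8 * M * n + 1) / n ≤ 4 * M * (8 * M + 1) := by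
    refine Nat.div_le_of_le_mul ?_
    calc 4 * M * (8 * M * n + 1) ≤ 4 * M * (8 * M * n + n) := Nat.mul_le_mul_left _ (by omega)
      _ = n * (4 * M * (8 * M + 1)) := by ring
  have hba : 4 * M * (8 * M * n + 1) / (8 * M * n + 1 + 1) ≤ 4 * M := by
    refine Nat.div_le_of_le_mul ?_
    calc 4 * M * (8 * M * n + 1) ≤ 4 * M * (8 * M * n + 1 + 1) := Nat.mul_le_mul_left _ (by omega)
      _ = (8 * M * n + 1 + 1) * (4 * M) := by ring
  -- (1) the closed slab barrier `E₁`: `η^K₀ ≤ 1 - P(V(b,h))`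
  have hR : 16 * M * n + 1 ≤ 2 * (8 * M * n + 1) := by
    have : 16 * M * n = 2 * (8 * M * n) := by ring
    omega
  have htile := slabCrossing_le_of_tiling (criticalProbI 3) n (16 * M * n) (8 * M * n + 1)
    (4 * M * (8 * M * n + 1)) hn hR hhb
  have hcompl := real_noCross_eq (criticalProbI 3) n (16 * M * n)
  have hw0 : 0 ≤ (bondPercolation (zdGraph 3) (criticalProbI 3)).real
      {ω : BondConfig (Site 3) | ∃ x ∈ box 3 n, ∃ y ∈ innerBoundary (zdGraph 3) (box 3 (16 * M * n)),
        ω ∈ openConnIn (↑(box 3 (16 * M * n)) : Set (Site 3)) x y} := measureReal_nonneg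
  have hKn : (2 * (4 * M * (8 * M * n + 1) / n) + 3) ^ 2 ≤ (2 * (4 * M * (8 * M + 1)) + 3) ^ 2 := by
    gcongr
  have hE1 : η ^ ((2 * (4 * M * (8 * M + 1)) + 3) ^ 2) ≤ 1 - (bondPercolation (zdGraph 3) (criticalProbI 3)).real
      {ω | ∃ x ∈ (box 3 (4 * M * (8 * M * n + 1))).filter (fun v => v 2 = -((8 * M * n + 1 : ℕ) : ℤ)),
        ∃ y ∈ (box 3 (4 * M * (8 * M * n + 1))).filter (fun v => v 2 = ((8 * M * n + 1 : ℕ) : ℤ)),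
          ω ∈ openConnIn (↑((box 3 (4 * M * (8 * M * n + 1))).filter
            (fun v => -((8 * M * n + 1 : ℕ) : ℤ) ≤ v 2 ∧ v 2 ≤ ((8 * M * n + 1 : ℕ) : ℤ))) : Set (Site 3)) x y} :=
    calc η ^ ((2 * (4 * M * (8 * M + 1)) + 3) ^ 2)
        ≤ (1 - (bondPercolation (zdGraph 3) (criticalProbI 3)).real
            {ω : BondConfig (Site 3) | ∃ x ∈ box 3 n, ∃ y ∈ innerBoundary (zdGraph 3) (box 3 (16 * M * n)),
              ω ∈ openConnIn (↑(box 3 (16 * M * n)) : Set (Site 3)) x y}) ^ ((2 * (4 * M * (8 * M + 1)) + 3) ^ 2) :=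
          pow_le_pow_left₀ hη0 (by linarith) _
      _ ≤ (1 - (bondPercolation (zdGraph 3) (criticalProbI 3)).real
            {ω : BondConfig (Site 3) | ∃ x ∈ box 3 n, ∃ y ∈ innerBoundary (zdGraph 3) (box 3 (16 * M * n)),
              ω ∈ openConnIn (↑(box 3 (16 * M * n)) : Set (Site 3)) x y}) ^ ((2 * (4 * M * (8 * M * n + 1) / n) + 3) ^ 2) :=
          pow_le_pow_of_le_one (by linarith) (by linarith) hKn
      _ ≤ _ := by linarith
  -- (2) the plate arm: `f₀ ≤ P(F⁺(a, b))`
  have hcr : c ≤ (bondPercolation (zdGraph 3) (criticalProbI 3)).real {ω : BondConfig (Site 3) | ∃ x ∈ box 3 (8 * M * n + 1 + 1 - 1),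
      ∃ y ∈ innerBoundary (zdGraph 3) (box 3 (4 * M * (8 * M * n + 1))),
        ω ∈ openConnIn (↑(box 3 (4 * M * (8 * M * n + 1))) : Set (Site 3)) x y} := by
    rw [Nat.add_sub_cancel]; exact hcross (8 * M * n + 1) hh1
  have hfaces := crossing_le_sum_faces (criticalProbI 3) (8 * M * n + 1 + 1) (4 * M * (8 * M * n + 1))
    (by omega) hlt
  have hsym := fun i : Fin 3 => face_symmetry (criticalProbI 3) (8 * M * n + 1 + 1) (4 * M * (8 * M * n + 1)) i
  rw [Finset.sum_congr rfl fun i _ => by rw [(hsym i).1, (hsym i).2], Finset.sum_const, Finset.card_univ,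
    Fintype.card_fin, nsmul_eq_mul, Nat.cast_ofNat] at hfaces
  have hplates := face_le_of_plates (criticalProbI 3) (8 * M * n + 1 + 1) (4 * M * (8 * M * n + 1))
    (by omega) hab
  have hf0 : 0 ≤ (bondPercolation (zdGraph 3) (criticalProbI 3)).real
      {ω | ∃ x : Site 3, |x 0| ≤ ((8 * M * n + 1 + 1 : ℕ) : ℤ) ∧ |x 1| ≤ ((8 * M * n + 1 + 1 : ℕ) : ℤ) ∧
        x 2 = ((8 * M * n + 1 + 1 : ℕ) : ℤ) ∧ ∃ y : Site 3, y 2 = ((4 * M * (8 * M * n + 1) : ℕ) : ℤ) ∧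
          ω ∈ openConnIn {v : Site 3 | ((8 * M * n + 1 + 1 : ℕ) : ℤ) ≤ v 2} x y} := measureReal_nonneg
  have hf1 : (bondPercolation (zdGraph 3) (criticalProbI 3)).real
      {ω | ∃ x : Site 3, |x 0| ≤ ((8 * M * n + 1 + 1 : ℕ) : ℤ) ∧ |x 1| ≤ ((8 * M * n + 1 + 1 : ℕ) : ℤ) ∧
        x 2 = ((8 * M * n + 1 + 1 : ℕ) : ℤ) ∧ ∃ y : Site 3, y 2 = ((4 * M * (8 * M * n + 1) : ℕ) : ℤ) ∧
          ω ∈ openConnIn {v : Site 3 | ((8 * M * n + 1 + 1 : ℕ) : ℤ) ≤ v 2} x y} ≤ 1 := measureReal_le_one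
  have hJn : (2 * (4 * M * (8 * M * n + 1) / (8 * M * n + 1 + 1)) + 3) ^ 2 ≤ (2 * (4 * M) + 3) ^ 2 := by
    gcongr
  have hpowJ : (1 - (bondPercolation (zdGraph 3) (criticalProbI 3)).real
      {ω | ∃ x : Site 3, |x 0| ≤ ((8 * M * n + 1 + 1 : ℕ) : ℤ) ∧ |x 1| ≤ ((8 * M * n + 1 + 1 : ℕ) : ℤ) ∧
        x 2 = ((8 * M * n + 1 + 1 : ℕ) : ℤ) ∧ ∃ y : Site 3, y 2 = ((4 * M * (8 * M * n + 1) : ℕ) : ℤ) ∧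
          ω ∈ openConnIn {v : Site 3 | ((8 * M * n + 1 + 1 : ℕ) : ℤ) ≤ v 2} x y}) ^ ((2 * (4 * M) + 3) ^ 2) ≤
      1 - c / 6 :=
    calc _ ≤ (1 - (bondPercolation (zdGraph 3) (criticalProbI 3)).real
      {ω | ∃ x : Site 3, |x 0| ≤ ((8 * M * n + 1 + 1 : ℕ) : ℤ) ∧ |x 1| ≤ ((8 * M * n + 1 + 1 : ℕ) : ℤ) ∧
        x 2 = ((8 * M * n + 1 + 1 : ℕ) : ℤ) ∧ ∃ y : Site 3, y 2 = ((4 * M * (8 * M * n + 1) : ℕ) : ℤ) ∧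
          ω ∈ openConnIn {v : Site 3 | ((8 * M * n + 1 + 1 : ℕ) : ℤ) ≤ v 2} x y}) ^
            ((2 * (4 * M * (8 * M * n + 1) / (8 * M * n + 1 + 1)) + 3) ^ 2) :=
          pow_le_pow_of_le_one (by linarith) (by linarith) hJn
      _ ≤ _ := by linarith
  -- root extraction (inlined): `1 - f ≤ (1 - c/6)^{1/J₀}`
  have hff₀ : 1 - (bondPercolation (zdGraph 3) (criticalProbI 3)).real
      {ω | ∃ x : Site 3, |x 0| ≤ ((8 * M * n + 1 + 1 : ℕ) : ℤ) ∧ |x 1| ≤ ((8 * M * n + 1 + 1 : ℕ) : ℤ) ∧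
        x 2 = ((8 * M * n + 1 + 1 : ℕ) : ℤ) ∧ ∃ y : Site 3, y 2 = ((4 * M * (8 * M * n + 1) : ℕ) : ℤ) ∧
          ω ∈ openConnIn {v : Site 3 | ((8 * M * n + 1 + 1 : ℕ) : ℤ) ≤ v 2} x y} ≤
      (1 - c / 6) ^ ((((2 * (4 * M) + 3) ^ 2 : ℕ) : ℝ)⁻¹) :=
    calc _ = ((1 - (bondPercolation (zdGraph 3) (criticalProbI 3)).real
      {ω | ∃ x : Site 3, |x 0| ≤ ((8 * M * n + 1 + 1 : ℕ) : ℤ) ∧ |x 1| ≤ ((8 * M * n + 1 + 1 : ℕ) : ℤ) ∧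
        x 2 = ((8 * M * n + 1 + 1 : ℕ) : ℤ) ∧ ∃ y : Site 3, y 2 = ((4 * M * (8 * M * n + 1) : ℕ) : ℤ) ∧
          ω ∈ openConnIn {v : Site 3 | ((8 * M * n + 1 + 1 : ℕ) : ℤ) ≤ v 2} x y}) ^ ((2 * (4 * M) + 3) ^ 2)) ^
            ((((2 * (4 * M) + 3) ^ 2 : ℕ) : ℝ)⁻¹) := (Real.pow_rpow_inv_natCast (by linarith) hJ₀0).symm
      _ ≤ _ := Real.rpow_le_rpow (pow_nonneg (by linarith) _) hpowJ (by positivity)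
  -- (3) the assembly inequality
  have hgeo := twoCluster_ge_barrier_mul_plate_sq (criticalProbI 3) (8 * M * n + 1 + 1) (4 * M * (8 * M * n + 1))
    (by omega) hab
  rw [Nat.add_sub_cancel] at hgeo
  refine le_trans ?_ hgeo
  refine mul_le_mul hE1 ?_ (sq_nonneg _) ((pow_nonneg hη0 _).trans hE1)
  exact pow_le_pow_left₀ (floor_pos hJ₀0 hc (by linarith)).le (by linarith) 2

end BoundedAspect

open BoundedAspect in
/-- **Two-cluster positivity at every bounded aspect along a scale sequence with bounded gaps**
(vdBvE 2022 Prop. 2, bond percolation on `ℤ³`): for every `M ≥ 2` there is `δ > 0` such that for EVERY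
`n ≥ 1`, `δ ≤ P_{p_c}(A₂(4n, M·4n))` or `δ ≤ P_{p_c}(A₂(aₙ, M·aₙ))` with `aₙ = 8Mn + 2`.
[cite: VandenbergVanengelenburg2022, Prop. 2] -/
theorem twoCluster_boundedAspect_pos : ∀ M : ℕ, 2 ≤ M → ∃ δ : ℝ, 0 < δ ∧ ∀ n : ℕ, 1 ≤ n →
    δ ≤ (bondPercolation (zdGraph 3) (criticalProbI 3)).real
        {ω | ∃ x ∈ box 3 (4 * n), ∃ x' ∈ box 3 (4 * n),
          ∃ y ∈ innerBoundary (zdGraph 3) (box 3 (M * (4 * n))),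
          ∃ y' ∈ innerBoundary (zdGraph 3) (box 3 (M * (4 * n))),
            ω ∈ openConnIn (↑(box 3 (M * (4 * n))) : Set (Site 3)) x y ∧
            ω ∈ openConnIn (↑(box 3 (M * (4 * n))) : Set (Site 3)) x' y' ∧
            ω ∉ openConnIn (↑(box 3 (M * (4 * n))) : Set (Site 3)) x x'} ∨
    δ ≤ (bondPercolation (zdGraph 3) (criticalProbI 3)).real
        {ω | ∃ x ∈ box 3 (8 * M * n + 2), ∃ x' ∈ box 3 (8 * M * n + 2),
          ∃ y ∈ innerBoundary (zdGraph 3) (box 3 (M * (8 * M * n + 2))),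
          ∃ y' ∈ innerBoundary (zdGraph 3) (box 3 (M * (8 * M * n + 2))),
            ω ∈ openConnIn (↑(box 3 (M * (8 * M * n + 2))) : Set (Site 3)) x y ∧
            ω ∈ openConnIn (↑(box 3 (M * (8 * M * n + 2))) : Set (Site 3)) x' y' ∧
            ω ∉ openConnIn (↑(box 3 (M * (8 * M * n + 2))) : Set (Site 3)) x x'} := by
  intro M hM
  obtain ⟨ε₀, hε₀, hdich⟩ := critTwoCluster_dichotomy M (by omega)
  obtain ⟨K₀, f₀, hf₀, hB⟩ := caseB M hM
  have hε₀2 : ε₀ / 2 ≤ 1 := by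
    have := (hdich 1 le_rfl).trans (add_le_add measureReal_le_one measureReal_le_one)
    linarith
  refine ⟨min (ε₀ / 2) ((ε₀ / 2) ^ K₀ * f₀ ^ 2), lt_min (half_pos hε₀) (by positivity), fun n hn => ?_⟩
  by_cases hA : ε₀ / 2 ≤ (bondPercolation (zdGraph 3) (criticalProbI 3)).real
      {ω | ∃ x ∈ box 3 (4 * n), ∃ x' ∈ box 3 (4 * n),
        ∃ y ∈ innerBoundary (zdGraph 3) (box 3 (4 * M * n)),
        ∃ y' ∈ innerBoundary (zdGraph 3) (box 3 (4 * M * n)),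
          ω ∈ openConnIn (↑(box 3 (4 * M * n)) : Set (Site 3)) x y ∧
          ω ∈ openConnIn (↑(box 3 (4 * M * n)) : Set (Site 3)) x' y' ∧
          ω ∉ openConnIn (↑(box 3 (4 * M * n)) : Set (Site 3)) x x'}
  · left
    rw [show M * (4 * n) = 4 * M * n by ring]
    exact (min_le_left _ _).trans hA
  · right
    push Not at hA
    have hη : ε₀ / 2 ≤ (bondPercolation (zdGraph 3) (criticalProbI 3)).real
        {ω : BondConfig (Site 3) | ¬ ∃ x ∈ box 3 n, ∃ y ∈ innerBoundary (zdGraph 3) (box 3 (16 * M * n)),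
          ω ∈ openConnIn (↑(box 3 (16 * M * n)) : Set (Site 3)) x y} := by
      linarith [hdich n hn]
    have hcase := hB n hn (ε₀ / 2) (half_pos hε₀).le hε₀2 hη
    have hkm : 8 * M * n + 2 ≤ M * (8 * M * n + 2) := Nat.le_mul_of_pos_left _ (by omega)
    have hmm' : M * (8 * M * n + 2) ≤ 4 * M * (8 * M * n + 1) :=
      calc M * (8 * M * n + 2) ≤ M * (4 * (8 * M * n + 1)) := Nat.mul_le_mul_left _ (by omega)
        _ = 4 * M * (8 * M * n + 1) := by ring
    have hmono := real_twoCluster_antitone (k := 8 * M * n + 2) hkm hmm'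
    exact (min_le_right _ _).trans (hcase.trans hmono)

/-- **Frequently along the scales, the aspect-`M` two-cluster event has probability `≥ δ(M)`.**
[cite: VandenbergVanengelenburg2022, Prop. 2] -/
theorem twoCluster_boundedAspect_frequently : ∀ M : ℕ, 2 ≤ M → ∃ δ : ℝ, 0 < δ ∧ ∃ᶠ k : ℕ in atTop,
    δ ≤ (bondPercolation (zdGraph 3) (criticalProbI 3)).real
        {ω | ∃ x ∈ box 3 k, ∃ x' ∈ box 3 k, ∃ y ∈ innerBoundary (zdGraph 3) (box 3 (M * k)),
          ∃ y' ∈ innerBoundary (zdGraph 3) (box 3 (M * k)),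
            ω ∈ openConnIn (↑(box 3 (M * k)) : Set (Site 3)) x y ∧
            ω ∈ openConnIn (↑(box 3 (M * k)) : Set (Site 3)) x' y' ∧
            ω ∉ openConnIn (↑(box 3 (M * k)) : Set (Site 3)) x x'} := by
  intro M hM
  obtain ⟨δ, hδ, h⟩ := twoCluster_boundedAspect_pos M hM
  refine ⟨δ, hδ, Filter.frequently_atTop.2 fun N => ?_⟩
  rcases h (N + 1) (by omega) with h1 | h2
  · exact ⟨4 * (N + 1), by omega, h1⟩
  · have hle := Nat.le_mul_of_pos_left (N + 1) (show 0 < 8 * M by omega)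
    exact ⟨8 * M * (N + 1) + 2, by omega, h2⟩

/-- **The print boundary of the crux (vdBvE 2022 Prop. 2): bounded multiplicative aspect is FALSE.**
For every `M ≥ 2`, the two-cluster probability `P_{p_c}(A₂(n, Mn))` does NOT tend to `0` — any proof of
`NearLinearTwoClusterDecay` must use `m/n → ∞` (here `m = ⌈n^{7/6}⌉`), i.e. the exponent `b > 0` of `U(b)` is
load-bearing. [cite: VandenbergVanengelenburg2022, Prop. 2] -/
theorem not_tendsto_twoCluster_boundedAspect : ∀ M : ℕ, 2 ≤ M →
    ¬ Tendsto (fun n : ℕ => (bondPercolation (zdGraph 3) (criticalProbI 3)).real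
        {ω | ∃ x ∈ box 3 n, ∃ x' ∈ box 3 n, ∃ y ∈ innerBoundary (zdGraph 3) (box 3 (M * n)),
          ∃ y' ∈ innerBoundary (zdGraph 3) (box 3 (M * n)),
            ω ∈ openConnIn (↑(box 3 (M * n)) : Set (Site 3)) x y ∧
            ω ∈ openConnIn (↑(box 3 (M * n)) : Set (Site 3)) x' y' ∧
            ω ∉ openConnIn (↑(box 3 (M * n)) : Set (Site 3)) x x'}) atTop (𝓝 0) := by
  intro M hM hT
  obtain ⟨δ, hδ, hfreq⟩ := twoCluster_boundedAspect_frequently M hM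
  obtain ⟨k, hk1, hk2⟩ := (hfreq.and_eventually (hT.eventually (gt_mem_nhds hδ))).exists
  exact absurd hk1 (not_le.2 hk2)

end Summit.CriticalPhenomena.PercolationContinuityZ3.Theorems.NearLinearTwoClusterDecay.Negative

end
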